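import Literature.Geometry.Lorentzian.KerrIngoingCoordRicci
import HarnessLib

/-!
# The Kerr metric in ingoing Kerr coordinates `(t*, r, μ, φ)`, IVb: the Ricci tensor vanishes
# (second half of the components, and the conclusion)

Continuation of `KerrIngoingCoordRicci.lean` (all results proved): the components `Ric(∂_k, ∂_l)`,
`k = 2, 3`, of the Ricci tensor of a smooth metric with the rational Kerr components
`Kerr.Ingoing.bilin M a` vanish (eight more rational identities in `r, μ, M, a`, closed by
`field_simp`/`ring` from the coordinate formula `Kerr.Ingoing.ricci_basis_aux`), hence all sixteen do
(`Kerr.Ingoing.ricci_basis`) and **such a metric is Ricci-flat at every regular point**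
(`Kerr.Ingoing.ricci_eq_zero_of_repr`) — the computational core of "the Kerr metric is a vacuum
solution" (Kerr, PRL 11 (1963); Kerr–Schild 1965, §3; O'Neill 1995, Ch. 2, Thm. 2.6.1).

## References

* R. P. Kerr, Phys. Rev. Lett. 11 (1963) 237–238; R. P. Kerr, A. Schild (1965), §3.
* B. O'Neill, *The geometry of Kerr black holes* (1995), Ch. 2, Thm. 2.6.1; *Semi-Riemannian
  geometry* (1983), Ch. 3, Lemma 3.38, Lemma 3.52.
-/

noncomputable section

set_option maxSynthPendingDepth 3

open Bundle TopologicalSpace Manifold Set Module Filter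
open scoped ContDiff Topology

namespace Literature.Geometry.Lorentzian

namespace Kerr

namespace Ingoing

variable (M a : ℝ)

section Ricci

variable {U : Opens E4}
  (g' : PseudoRiemannianMetric 𝓘(ℝ, E4) ∞ E4 (TangentSpace 𝓘(ℝ, E4) : U → Type _))
  [g'.HasLeviCivita] (hG : ∀ y : U, g'.val y = bilin M a y) (x : U) (hx : (x : E4) ∈ regularSet a)

include hG hx in
/-- A component of `Kerr.Ingoing.ricci_basis`: `Ric(∂_2, ∂_0) = 0` for the Kerr components.
[cite: KerrSchild1965, §3] -/
theorem ricci_basisVector_20 : g'.ricci x (E4.basisVector 2) (E4.basisVector 0) = 0 := by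
  have hS := hx.1
  have hP := hx.2
  rw [ricci_basis_aux M a g' hG x hx]
  simp only [ginvMat, Fin.sum_univ_four, Matrix.of_apply, Matrix.cons_val', Matrix.cons_val_zero,
    Matrix.cons_val_one, Matrix.cons_val, Matrix.empty_val', Matrix.cons_val_fin_one, Fin.isValue,
    zero_mul, add_zero, zero_add]
  simp only [fderiv_koszulForm_bilin M a hx, koszulForm_bilin M a hx, dKoszulR, dKoszulM,
    bilinR_apply, bilinM_apply, bilinRR_apply, bilinRM_apply, bilinMM_apply, bv_apply, Fin.isValue,
    Fin.reduceEq, if_true, if_false, mul_one, one_mul, mul_zero, zero_mul, add_zero, zero_add,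
    sub_zero, zero_sub]
  simp only [h00, c22r, c33r, c33m, h00r, h00m, h03r, h03m, h00rm, h03rm, scalarH, scalarHr,
    scalarHm, scalarHrm, sigma, sinSq] at hS hP ⊢
  field_simp
  ring

include hG hx in
/-- A component of `Kerr.Ingoing.ricci_basis`: `Ric(∂_2, ∂_1) = 0` for the Kerr components.
[cite: KerrSchild1965, §3] -/
theorem ricci_basisVector_21 : g'.ricci x (E4.basisVector 2) (E4.basisVector 1) = 0 := by
  have hS := hx.1
  have hP := hx.2
  rw [ricci_basis_aux M a g' hG x hx]
  simp only [ginvMat, Fin.sum_univ_four, Matrix.of_apply, Matrix.cons_val', Matrix.cons_val_zero,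
    Matrix.cons_val_one, Matrix.cons_val, Matrix.empty_val', Matrix.cons_val_fin_one, Fin.isValue,
    zero_mul, add_zero, zero_add]
  simp only [fderiv_koszulForm_bilin M a hx, koszulForm_bilin M a hx, dKoszulR, dKoszulM,
    bilinR_apply, bilinM_apply, bilinRR_apply, bilinRM_apply, bilinMM_apply, bv_apply, Fin.isValue,
    Fin.reduceEq, if_true, if_false, mul_one, one_mul, mul_zero, zero_mul, add_zero, zero_add,
    sub_zero, zero_sub]
  simp only [h00, c22r, c22m, c33r, c33m, h00r, h00m, h03r, h03m, c22rm, c33rm, h00rm, h03rm,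
    scalarH, scalarHr, scalarHm, scalarHrm, sigma, sinSq] at hS hP ⊢
  field_simp
  ring

include hG hx in
/-- A component of `Kerr.Ingoing.ricci_basis`: `Ric(∂_2, ∂_2) = 0` for the Kerr components.
[cite: KerrSchild1965, §3] -/
theorem ricci_basisVector_22 : g'.ricci x (E4.basisVector 2) (E4.basisVector 2) = 0 := by
  have hS := hx.1
  have hP := hx.2
  rw [ricci_basis_aux M a g' hG x hx]
  simp only [ginvMat, Fin.sum_univ_four, Matrix.of_apply, Matrix.cons_val', Matrix.cons_val_zero,
    Matrix.cons_val_one, Matrix.cons_val, Matrix.empty_val', Matrix.cons_val_fin_one, Fin.isValue,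
    zero_mul, add_zero, zero_add]
  simp only [fderiv_koszulForm_bilin M a hx, koszulForm_bilin M a hx, dKoszulR, dKoszulM,
    bilinR_apply, bilinM_apply, bilinRR_apply, bilinRM_apply, bilinMM_apply, bv_apply, Fin.isValue,
    Fin.reduceEq, if_true, if_false, mul_one, one_mul, mul_zero, zero_mul, add_zero, zero_add,
    sub_zero, zero_sub]
  simp only [h00, c22r, c22m, c33r, c33m, h00r, h00m, h03r, h03m, c22rr, c22mm, c33mm, h00mm,
    h03mm, scalarH, scalarHr, scalarHm, scalarHmm, sigma, sinSq] at hS hP ⊢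
  field_simp
  ring

include hG hx in
/-- A component of `Kerr.Ingoing.ricci_basis`: `Ric(∂_2, ∂_3) = 0` for the Kerr components.
[cite: KerrSchild1965, §3] -/
theorem ricci_basisVector_23 : g'.ricci x (E4.basisVector 2) (E4.basisVector 3) = 0 := by
  have hS := hx.1
  have hP := hx.2
  rw [ricci_basis_aux M a g' hG x hx]
  simp only [ginvMat, Fin.sum_univ_four, Matrix.of_apply, Matrix.cons_val', Matrix.cons_val_zero,
    Matrix.cons_val_one, Matrix.cons_val, Matrix.empty_val', Matrix.cons_val_fin_one, Fin.isValue,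
    zero_mul, add_zero, zero_add]
  simp only [fderiv_koszulForm_bilin M a hx, koszulForm_bilin M a hx, dKoszulR, dKoszulM,
    bilinR_apply, bilinM_apply, bilinRR_apply, bilinRM_apply, bilinMM_apply, bv_apply, Fin.isValue,
    Fin.reduceEq, if_true, if_false, mul_one, one_mul, mul_zero, zero_mul, add_zero, zero_add,
    sub_zero, zero_sub]
  simp only [h00, c22r, c33r, c33m, h00r, h00m, h03r, h03m, c33rm, h00rm, h03rm, scalarH, scalarHr,
    scalarHm, scalarHrm, sigma, sinSq] at hS hP ⊢
  field_simp
  ring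

include hG hx in
/-- A component of `Kerr.Ingoing.ricci_basis`: `Ric(∂_3, ∂_0) = 0` for the Kerr components.
[cite: KerrSchild1965, §3] -/
theorem ricci_basisVector_30 : g'.ricci x (E4.basisVector 3) (E4.basisVector 0) = 0 := by
  have hS := hx.1
  have hP := hx.2
  rw [ricci_basis_aux M a g' hG x hx]
  simp only [ginvMat, Fin.sum_univ_four, Matrix.of_apply, Matrix.cons_val', Matrix.cons_val_zero,
    Matrix.cons_val_one, Matrix.cons_val, Matrix.empty_val', Matrix.cons_val_fin_one, Fin.isValue,
    zero_mul, add_zero, zero_add]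
  simp only [fderiv_koszulForm_bilin M a hx, koszulForm_bilin M a hx, dKoszulR, dKoszulM,
    bilinR_apply, bilinM_apply, bilinRR_apply, bilinRM_apply, bilinMM_apply, bv_apply, Fin.isValue,
    Fin.reduceEq, if_true, if_false, mul_one, one_mul, mul_zero, zero_mul, add_zero, zero_add,
    sub_zero, zero_sub]
  simp only [h00, c22r, c22m, c33r, c33m, h00r, h00m, h03r, h03m, h00rr, h00mm, h03rr, h03mm,
    scalarH, scalarHr, scalarHm, scalarHrr, scalarHmm, sigma, sinSq] at hS hP ⊢
  field_simp
  ring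

include hG hx in
/-- A component of `Kerr.Ingoing.ricci_basis`: `Ric(∂_3, ∂_1) = 0` for the Kerr components.
[cite: KerrSchild1965, §3] -/
theorem ricci_basisVector_31 : g'.ricci x (E4.basisVector 3) (E4.basisVector 1) = 0 := by
  have hS := hx.1
  have hP := hx.2
  rw [ricci_basis_aux M a g' hG x hx]
  simp only [ginvMat, Fin.sum_univ_four, Matrix.of_apply, Matrix.cons_val', Matrix.cons_val_zero,
    Matrix.cons_val_one, Matrix.cons_val, Matrix.empty_val', Matrix.cons_val_fin_one, Fin.isValue,
    zero_mul, add_zero, zero_add]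
  simp only [fderiv_koszulForm_bilin M a hx, koszulForm_bilin M a hx, dKoszulR, dKoszulM,
    bilinR_apply, bilinM_apply, bilinRR_apply, bilinRM_apply, bilinMM_apply, bv_apply, Fin.isValue,
    Fin.reduceEq, if_true, if_false, mul_one, one_mul, mul_zero, zero_mul, add_zero, zero_add,
    sub_zero, zero_sub]
  simp only [h00, c22r, c22m, c33r, c33m, h00r, h00m, h03r, h03m, c33rr, h00rr, h00mm, h03rr,
    h03mm, scalarH, scalarHr, scalarHm, scalarHrr, scalarHmm, sigma, sinSq] at hS hP ⊢
  field_simp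
  ring

include hG hx in
/-- A component of `Kerr.Ingoing.ricci_basis`: `Ric(∂_3, ∂_2) = 0` for the Kerr components.
[cite: KerrSchild1965, §3] -/
theorem ricci_basisVector_32 : g'.ricci x (E4.basisVector 3) (E4.basisVector 2) = 0 := by
  have hS := hx.1
  have hP := hx.2
  rw [ricci_basis_aux M a g' hG x hx]
  simp only [ginvMat, Fin.sum_univ_four, Matrix.of_apply, Matrix.cons_val', Matrix.cons_val_zero,
    Matrix.cons_val_one, Matrix.cons_val, Matrix.empty_val', Matrix.cons_val_fin_one, Fin.isValue,
    zero_mul, add_zero, zero_add]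
  simp only [fderiv_koszulForm_bilin M a hx, koszulForm_bilin M a hx, dKoszulR, dKoszulM,
    bilinR_apply, bilinM_apply, bilinRR_apply, bilinRM_apply, bilinMM_apply, bv_apply, Fin.isValue,
    Fin.reduceEq, if_true, if_false, mul_one, one_mul, mul_zero, zero_mul, add_zero, zero_add,
    sub_zero, zero_sub]
  simp only [h00, c22r, c33r, c33m, h00r, h00m, h03r, h03m, c33rm, h00rm, h03rm, scalarH, scalarHr,
    scalarHm, scalarHrm, sigma, sinSq] at hS hP ⊢
  field_simp
  ring

include hG hx in
/-- A component of `Kerr.Ingoing.ricci_basis`: `Ric(∂_3, ∂_3) = 0` for the Kerr components.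
[cite: KerrSchild1965, §3] -/
theorem ricci_basisVector_33 : g'.ricci x (E4.basisVector 3) (E4.basisVector 3) = 0 := by
  have hS := hx.1
  have hP := hx.2
  rw [ricci_basis_aux M a g' hG x hx]
  simp only [ginvMat, Fin.sum_univ_four, Matrix.of_apply, Matrix.cons_val', Matrix.cons_val_zero,
    Matrix.cons_val_one, Matrix.cons_val, Matrix.empty_val', Matrix.cons_val_fin_one, Fin.isValue,
    zero_mul, add_zero, zero_add]
  simp only [fderiv_koszulForm_bilin M a hx, koszulForm_bilin M a hx, dKoszulR, dKoszulM,
    bilinR_apply, bilinM_apply, bilinRR_apply, bilinRM_apply, bilinMM_apply, bv_apply, Fin.isValue,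
    Fin.reduceEq, if_true, if_false, mul_one, one_mul, mul_zero, zero_mul, add_zero, zero_add,
    sub_zero, zero_sub]
  simp only [h00, c22r, c22m, c33r, c33m, h00r, h00m, h03r, h03m, c33rr, c33mm, h00rr, h00mm,
    scalarH, scalarHr, scalarHm, scalarHrr, scalarHmm, sigma, sinSq] at hS hP ⊢
  field_simp
  ring

include hG hx in
/-- **The coordinate components of the Ricci tensor vanish**: `Ric_x(∂_k, ∂_l) = 0` for all
`k, l`, for every smooth metric whose components are the Kerr components `Kerr.Ingoing.bilin M a`
(sixteen rational identities in `r, μ, M, a`). Kerr 1963; Kerr–Schild 1965, §3; O'Neill 1995,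
Ch. 2, Thm. 2.6.1. [cite: KerrSchild1965, §3] -/
theorem ricci_basis (k l : Fin 4) : g'.ricci x (E4.basisVector k) (E4.basisVector l) = 0 := by
  fin_cases k <;> fin_cases l
  exacts [ricci_basisVector_00 M a g' hG x hx, ricci_basisVector_01 M a g' hG x hx,
    ricci_basisVector_02 M a g' hG x hx, ricci_basisVector_03 M a g' hG x hx,
    ricci_basisVector_10 M a g' hG x hx, ricci_basisVector_11 M a g' hG x hx,
    ricci_basisVector_12 M a g' hG x hx, ricci_basisVector_13 M a g' hG x hx,
    ricci_basisVector_20 M a g' hG x hx, ricci_basisVector_21 M a g' hG x hx,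
    ricci_basisVector_22 M a g' hG x hx, ricci_basisVector_23 M a g' hG x hx,
    ricci_basisVector_30 M a g' hG x hx, ricci_basisVector_31 M a g' hG x hx,
    ricci_basisVector_32 M a g' hG x hx, ricci_basisVector_33 M a g' hG x hx]

include hG hx in
/-- **A smooth metric with the Kerr components is Ricci-flat at every regular point**: if
`g'` is a `C^∞` metric on an open subset of the coordinate space `E4` whose components are
`Kerr.Ingoing.bilin M a` and `x` lies in the regular set `{Σ ≠ 0, μ² ≠ 1}`, then `Ric^{g'}_x = 0`
(a bilinear form vanishing on the coordinate basis). Kerr, PRL 11 (1963); Kerr–Schild 1965, §3;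
O'Neill 1995, Ch. 2, Thm. 2.6.1. [cite: KerrSchild1965, §3] -/
theorem ricci_eq_zero_of_repr : g'.ricci x = 0 := by
  have h := ricci_basis M a g' hG x hx
  set β : Module.Basis (Fin 4) ℝ (TangentSpace 𝓘(ℝ, E4) x) :=
    (EuclideanSpace.basisFun (Fin 4) ℝ).toBasis with hβdef
  have hβ : ∀ i, β i = E4.basisVector i := fun i ↦ by
    rw [hβdef]
    exact (congrFun (EuclideanSpace.basisFun (Fin 4) ℝ).coe_toBasis i).trans
      (EuclideanSpace.basisFun_apply _ _ i)
  refine LinearMap.BilinForm.ext_basis β fun k l ↦ ?_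
  rw [hβ, hβ, h k l]
  rfl

end Ricci

end Ingoing

end Kerr

end Literature.Geometry.Lorentzian

end
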